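import Literature.NumberTheory.GaloisCohomology.KolyvaginSystemsRankZero
import Literature.NumberTheory.GaloisCohomology.Sakamoto2024KolyvaginRankOne
import HarnessLib

/-!
# Sakamoto 2024, Theorem 8.5 (2)–(3): `KS₀(T, 𝓕)` is free of rank one and `I_R(δ(κ)_d)` is the
# initial Fitting ideal of the dual Selmer group — the case `R = ℤ/3^m`, `K = ℚ` (two named facts,
# parameter `m`; typing layer `bsd-littype` seat 10, gen 2; siblings `Sakamoto2024KolyvaginRankOne.lean`
# (Thm. 4.4 (1)) and `Sakamoto2024KolyvaginFittingIdeal.lean` (Thm. 4.4 (2)), whose binders are copied)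

Topic `NumberTheory/GaloisCohomology`.  TWO cite-tagged named facts (`def … : Prop`, parameter
`m ≥ 1`), WEAKER than print (special case of the coefficient ring and of the base field), never
stronger; no theorem about them; the vocabulary (`KS₀`, `δ(κ)_d`, `𝓕^𝔮(d)`, residually self-dual,
`VanishesOnTransverse`) is `KolyvaginSystemsRankZero.lean`.  Honest framing: research typing; a
typed fact is weaker than print or equal; typed ≠ proved ≠ endorsed; nothing is booked here.

## Source, verbatim

R. Sakamoto, *The theory of Kolyvagin systems for `p = 3`*, J. Théor. Nombres Bordeaux **36** (2024)
919–946, §8, pp. 937–938 (read 2026-08-26 on the publisher's OA PDF):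

> "**Lemma 8.4.** For any prime `𝔮 ∈ 𝒫`, the Selmer structure `𝓕^𝔮` is cartesian with
> `χ(𝓕^𝔮) = 1` and residually coisotropic. […] By Lemma 8.4, we can use Theorem 4.4 (or
> Propositions 7.6 and 7.7) for `𝓕^𝔮`. Hence from the same arguments of the proofs of
> [24, Theorem 5.5, Proposition 5.6, and Theorem 5.8], we obtain the following result:
> **Theorem 8.5.** Suppose that `𝓕` is cartesian and residually self-dual.
> (1) The `R`-homomorphism `Reg₀ : SS₀(T, 𝓕) → KS₀(T, 𝓕)` defined in [24, Lemma 5.4] is an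
> isomorphism.
> (2) For any square-free ideal `d ∈ 𝒩` with `H¹_{(𝓕^*)_𝔮(d)}(K, T^∨(1)) = 0`, the projection map
> `KS₀(T, 𝓕) → H¹_{𝓕^𝔮(d)}(K, T) ⊗_ℤ R` is an isomorphism. Moreover, the `R`-module `KS₀(T, 𝓕)`
> is free of rank 1.
> (3) Let `κ ∈ KS₀(T, 𝓕)` be a basis. For any square-free ideal `d ∈ 𝒩`, we have
> `I_R(δ(κ)_d) = Fitt⁰_R(H¹_{𝓕^*(d)}(K, T^∨(1))^∨)`."

Setting: §2 (p. 921) — `R` zero-dimensional Gorenstein local, `3^α R = 0`, residue characteristic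
`3`; `T` free of finite rank with (H.1), (H.2), (H.3), (H.SD); `(−)^∨ := Hom(−, ℚ₃/ℤ₃)` — quoted in
full in `Sakamoto2024KolyvaginRankOne.lean`; Defs. 3.3, 3.5, 4.2, Rem. 4.3, 8.1, 8.2 as quoted there
and in `KolyvaginSystemsRankZero.lean`.  In (2) the prime `𝔮` is a prime of `𝒫` with `(d, 𝔮) ∈ M`
(R. Sakamoto, JTNB 33 (2021) Prop. 5.6, p. 1092: "For any element `(n, q) ∈ M` with
`H¹_{(𝓕^*)_q(n)}(k, T^∨(1)) = 0`, the projection map `KS₀(T, 𝓕, Q) → H¹_{𝓕^q(n)}(k, T) ⊗_ℤ G_n` is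
an isomorphism") and "`⊗_ℤ R`" is the printed text (read `⊗_ℤ G_d`, loc. cit.).  The text layer of
the PDF carries no overlines; on p. 938 the glyph stream of (2) and (3) draws NO bar over `𝓕` or
`T` in `H¹_{(𝓕^*)_𝔮(d)}(K, T^∨(1))` and `H¹_{𝓕^*(d)}(K, T^∨(1))` (checked on the content stream,
where the bars of Def. 8.2, p. 937, ARE drawn as rules): both groups are at the FULL level
`T^∨(1) = Hom(T, μ_{3^α})`, as in Thm. 4.4 (2) / Prop. 7.7.

## What is typed, and how it is weaker than print

Both facts carry the binder block of `kolyvaginSystems_idealOfBasis_eq_fittingIdeal_zmod_three_pow`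
VERBATIM (residual pair `red`/`incl` with `incl ∘ red = 3^{m−1}`; (H.1)–(H.3), (H.SD) `θ`; residual
Poitou–Tate family `inv`; `S ∋ ∞, 3, S_ram(T)`, `𝓕` unramified outside `S`; Sakamoto's `𝒫`,
cyclotomic transverse conditions, canonical comparison maps for generators `η`
(`HasCanonicalComparison`, generator-fixed convention of Kim, AJM 148 §2.2.2); a full-level
Poitou–Tate family `inv'` for the dual Selmer groups of `T^∨(1) = Hom(T, μ_{3^m})`), EXCEPT that the
two hypotheses of Thm. 4.4 on `𝓕` (core rank one, residually coisotropic) are REPLACED by the two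
hypotheses of Thm. 8.5 (cartesian — kept — and residually self-dual, Def. 8.2,
`LocalInvariants.IsResiduallySelfDual`), and three binders are ADDED: the trivialisations
`t_𝔮 : H¹_{/ur}(ℚ_𝔮, T) → ℤ/3^m`, bijective at every `𝔮 ∈ 𝒫` (§8: "we fix an `R`-isomorphism
`H¹_{/ur}(K_𝔮,T) ≅ R` for each prime `𝔮 ∈ 𝒫`"; any additive bijection with `ℤ/3^m` is `R`-linear),
and `KolyvaginDatum.VanishesOnTransverse` (§4: `φ^{fs}_𝔮 = φ^{fs}_𝔮 ∘ pr_ur` kills `H¹_tr`).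
* (2) `kolyvaginSystemsZero_freeRankOne_zmod_three_pow_at m`: `KS₀(T, 𝓕)`
  (`KolyvaginDatum.kolyvaginSystemsZero`) is free of rank one over `ℤ/3^m` (`IsFreeRankOneZMod`) and,
  for every `(d, 𝔮) ∈ M` whose full-level dual Selmer group `H¹_{(𝓕^𝔮(d))^*}(ℚ, T^∨(1))`
  (`inv'.dualSelmerStructure ρ (D.atPair 𝓕 d 𝔮)`; `= H¹_{(𝓕^*)_𝔮(d)}` of print by
  `(𝓕^a_b(c))^* = (𝓕^*)^b_a(c)`, the transverse conditions being their own annihilators — the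
  convention of `Sakamoto2024KolyvaginFittingIdeal.lean`) vanishes, the projection `κ ↦ κ_{d,𝔮}`
  onto `H¹_{𝓕^𝔮(d)}(ℚ, T)` is bijective.
* (3) `kolyvaginSystemsZero_span_delta_eq_zmod_three_pow_at m`, UNFOLDED for `R = ℤ/3^m`: if
  `KS₀(T, 𝓕)` is free of rank one (conclusion (2), kept as a hypothesis so that "basis" = generator
  is print's word), then for every basis `κ` and level `d`,
  `(δ(κ)_d) = (#H¹_{𝓕(d)^*}(ℚ, T^∨(1))) · ℤ/3^m` as ideals — `I_R(x) = (x)` for `x ∈ R`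
  (`KolyvaginSystem.idealOfElement_self`) and `Fitt⁰_R(N^∨) = Fitt⁰_ℤ(N^∨)·R = (#N)·R` for a finite
  `R`-module `N` (the Pontryagin dual has the same elementary divisors).
WEAKER than print: `R = ℤ/3^m`, `K = ℚ` only (TODO(general form): zero-dimensional Gorenstein `R`,
any number field `K`); self-duality demanded at every place of `S` (vacuous at `∞`: `H¹(ℝ, T̄) = 0`
for `3`-torsion `T̄`).  NOT typed (typed GAP): (1) `Reg₀ : SS₀ ⥲ KS₀` — no Stark systems in the tree.

References: [Sakamoto2024] §8 Lemma 8.4, Thm. 8.5 (pp. 937–938), §4 (p. 925), Def. 4.2 / Rem. 4.3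
(p. 926); [Sakamoto2021RankZero] Thm. 5.5, Prop. 5.6 (pp. 1091–1092), Def. 5.7, Thm. 5.8 (i)
(pp. 1093–1094); [Kim2022StructureSelmer] §2.2.2; [Rubin2011] Def. 1.9.6, Def. 2.2.1.
-/

noncomputable section

open scoped Classical NumberField ContRepresentation
open Function Field NumberField IsDedekindDomain
open Literature.NumberTheory.GaloisRepresentations Literature.NumberTheory.GaloisRepresentations.DiscreteGaloisModule
  Literature.NumberTheory.GaloisCohomology

/-! ## G. Theorem 8.5 (2)–(3) for `R = ℤ/3^m`, `K = ℚ` (named facts, parameter `m`) -/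

namespace Literature.NumberTheory.GaloisCohomology.Sakamoto2024

/-- **Sakamoto 2024, Thm. 8.5 (2), for `R = ℤ/3^m` (`m ≥ 1` a parameter) and `K = ℚ`.**  In the
setting of `kolyvaginSystems_idealOfBasis_eq_fittingIdeal_zmod_three_pow` (same binders, verbatim:
`T` finite free over `ℤ/3^m` with the residual pair `red`, `incl`, `incl ∘ red = 3^{m−1}`; (H.1),
(H.2) with `τ`, (H.3), (H.SD) with `θ`; a residual Poitou–Tate family `inv`; `𝓕` unramified outside
`S ∋ ∞, 3, S_ram(T)`; the datum `D` with Sakamoto's primes `𝒫`, the cyclotomic transverse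
conditions and the canonical comparison maps for the generators `η`; a full-level Poitou–Tate
family `inv'` for the dual Selmer groups of `T^∨(1) = Hom(T, μ_{3^m})`), with the hypotheses of
Thm. 8.5 on `𝓕` — CARTESIAN (Def. 3.5) and RESIDUALLY SELF-DUAL (Def. 8.2) — in place of those of
Thm. 4.4, with the slot `φ^{fs}_𝔮` killing `H¹_tr(K_𝔮, T)` (`pr_ur`, §4) and with the fixed
trivialisations `t_𝔮 : H¹_{/ur}(ℚ_𝔮, T) ⥲ ℤ/3^m` at the primes of `𝒫` (§8: "we fix an
`R`-isomorphism `H¹_{/ur}(K_𝔮, T) ≅ R` for each prime `𝔮 ∈ 𝒫`"): THEN `KS₀(T, 𝓕)` is free of rank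
one over `ℤ/3^m`, and for every pair `(d, 𝔮) ∈ M` with `H¹_{(𝓕^𝔮(d))^*}(ℚ, T^∨(1)) = 0` (the dual
Selmer group of `𝓕^𝔮(d)` for `inv'`; `= H¹_{(𝓕^*)_𝔮(d)}(K, T^∨(1))` of print, `(𝓕^a_b(c))^* =
(𝓕^*)^b_a(c)`) the projection `KS₀(T, 𝓕) → H¹_{𝓕^𝔮(d)}(ℚ, T)`, `κ ↦ κ_{d,𝔮}`, is bijective
("the projection map `KS₀(T,𝓕) → H¹_{𝓕^𝔮(d)}(K,T) ⊗_ℤ R` [sic; `⊗_ℤ G_d`] is an isomorphism.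
Moreover, the `R`-module `KS₀(T,𝓕)` is free of rank 1").  Weaker than print: `R = ℤ/3^m`, `K = ℚ`;
self-duality asked at every `v ∈ S` (vacuous at `∞` for `3`-torsion coefficients).  Conclusion (1)
(`Reg₀ : SS₀ ⥲ KS₀`) is not typed (no Stark systems in the tree).
[cite: Sakamoto2024, Thm. 8.5 (2) (p. 938); Defs. 8.1, 8.2 (p. 937); §4 (p. 925); §2 (p. 921); Defs. 3.3, 3.5]
[cite: Sakamoto2021RankZero, Def. 5.1, Rem. 5.3 (p. 1089), Thm. 5.5, Prop. 5.6 (pp. 1091–1092)]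
[cite: Kim2022StructureSelmer, §2.2.2 (generator-fixed convention)] -/
def kolyvaginSystemsZero_freeRankOne_zmod_three_pow_at (m : ℕ) [NeZero m] : Prop :=
  ∀ (M : Type) [AddCommGroup M] [TopologicalSpace M] [DiscreteTopology M] [Finite M]
    (Mbar : Type) [AddCommGroup Mbar] [TopologicalSpace Mbar] [DiscreteTopology Mbar] [Finite Mbar]
    [Module (ZMod (3 ^ m)) M] [Module.Free (ZMod (3 ^ m)) M] [Module.Finite (ZMod (3 ^ m)) M]
    (ρ : DiscreteGaloisModule ℚ M) (ρbar : DiscreteGaloisModule ℚ Mbar)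
    (red : ρ.toContRepresentation →ⁱL ρbar.toContRepresentation)
    (incl : ρbar.toContRepresentation →ⁱL ρ.toContRepresentation)
    (τ : absoluteGaloisGroup ℚ)
    (θ : ρbar.toContRepresentation →ⁱL (ρbar.tateDual 3).toContRepresentation)
    (inv : LocalInvariants ℚ 3)
    (S : Finset (Place ℚ)) (𝓕 : SelmerStructure ρ) (D : KolyvaginDatum ρ)
    (η : (q : HeightOneSpectrum (𝓞 ℚ)) → (ZMod (Ideal.absNorm q.asIdeal))ˣ)
    (t : (q : HeightOneSpectrum (𝓞 ℚ)) → SingularQuotient (GaloisRep.toLocal q ρ) →+ ZMod (3 ^ m)),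
    -- the residual pair is `T ↠ T/3T`, `T/3T ↪ T` with `incl ∘ red = 3^{m-1}`
    Function.Surjective red →
    (∀ x : M, red x = 0 ↔ ∃ y : M, x = (3 : ℤ) • y) →
    (∀ x : M, incl (red x) = ((3 : ℤ) ^ (m - 1)) • x) →
    -- (H.1)
    (∀ H : AddSubgroup Mbar, (∀ (σ : absoluteGaloisGroup ℚ) (x : Mbar), x ∈ H → ρbar σ x ∈ H) →
      H = ⊥ ∨ H = ⊤) →
    -- (H.2)
    τ ∈ rootsOfUnityFixer ℚ (3 ^ m) → Nonempty (cokerSubOne ρ τ ≃+ ZMod (3 ^ m)) →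
    -- (H.3)
    (∀ f : contOneCocycles ρbar.toTopRep,
      (∀ u : absoluteGaloisGroup ℚ, ρ u = 1 → u ∈ rootsOfUnityFixer ℚ (3 ^ m) → f.1 u = 0) →
        oneCocycleClass ρbar.toTopRep f = 0) →
    -- (H.SD)
    Function.Bijective θ →
    -- the residual local duality family (Poitou–Tate), for the conditions of Def. 8.2 on `T̄`
    inv.IsPerfect → inv.SumLocalTermEqZero → inv.UnramifiedOrthogonal → inv.SelmerComplement →
    -- `S(𝓕) = S ⊇ {∞, 3} ∪ S_ram(T)`, `H¹_ur` outside `S`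
    (∀ w : InfinitePlace ℚ, (Sum.inl w : Place ℚ) ∈ S) →
    (∀ v : HeightOneSpectrum (𝓞 ℚ), (Sum.inr v : Place ℚ) ∉ S →
      ((3 : ℕ) : 𝓞 ℚ) ∉ v.asIdeal ∧ GaloisRep.IsUnramifiedAt v ρ) →
    𝓕.IsUnramifiedOutside S →
    -- the hypotheses of Thm. 8.5 on `𝓕`: cartesian (Def. 3.5) and residually self-dual (Def. 8.2)
    𝓕.IsCartesian red incl S →
    inv.IsResiduallySelfDual (𝓕.induced red) θ S →
    -- the Kolyvagin datum: Sakamoto's `𝒫`, the transverse conditions, THE comparison maps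
    -- (canonical on `H¹_ur`, zero on `H¹_tr`: `φ^{fs}_𝔮 ∘ pr_ur`)
    D.primes = frobeniusClassPrimes ρ {v | (Sum.inr v : Place ℚ) ∈ S} τ (3 ^ m) →
    D.transverse = cyclotomicTransverse ρ →
    D.HasCanonicalComparison (3 ^ m) η →
    D.VanishesOnTransverse →
    -- §8: the fixed isomorphisms `H¹_{/ur}(ℚ_𝔮, T) ≅ R` at the primes of `𝒫`
    (∀ q ∈ D.primes, Function.Bijective (t q)) →
    -- a Poitou–Tate family at the FULL level `3^m`, for the dual Selmer groups of
    -- `T^∨(1) = Hom(T, μ_{3^m}) = ρ.tateDual (3^m)` in the hypothesis of (2)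
    ∀ inv' : LocalInvariants ℚ (3 ^ m),
      inv'.IsPerfect → inv'.SumLocalTermEqZero → inv'.UnramifiedOrthogonal → inv'.SelmerComplement →
    -- conclusion (2): `KS₀(T, 𝓕)` is free of rank one, and the projection `κ ↦ κ_{d,𝔮}` is
    -- bijective at every `(d, 𝔮) ∈ M` with `H¹_{(𝓕^𝔮(d))^*}(ℚ, T^∨(1)) = 0`
    KolyvaginSystem.IsFreeRankOneZMod (D.kolyvaginSystemsZero (3 ^ m) t 𝓕) (3 ^ m) ∧
      ∀ (d : Finset (HeightOneSpectrum (𝓞 ℚ))) (q : HeightOneSpectrum (𝓞 ℚ)) (hdq : D.IsPair d q),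
        (inv'.dualSelmerStructure ρ (D.atPair 𝓕 d q)).selmerGroup = ⊥ →
        Function.Bijective fun κ : D.kolyvaginSystemsZero (3 ^ m) t 𝓕 =>
          (⟨κ.1 d q, ((D.mem_kolyvaginSystemsZero_iff (3 ^ m) t 𝓕 κ.1).mp κ.2).mem_selmerGroup d q
              hdq⟩ : (D.atPair 𝓕 d q).selmerGroup)

/-- **Sakamoto 2024, Thm. 8.5 (3), for `R = ℤ/3^m` (`m ≥ 1` a parameter) and `K = ℚ`, unfolded to
cardinalities.**  Same binders as `kolyvaginSystemsZero_freeRankOne_zmod_three_pow_at m`, word for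
word; conclusion: IF `KS₀(T, 𝓕)` is free of rank one over `ℤ/3^m` (print: Thm. 8.5 (2); kept as a
hypothesis so that "basis" is print's word), then for every basis `κ` (a generator:
`ℤκ = KS₀(T, 𝓕)`) and every level `d ∈ 𝒩`, writing `N_d = H¹_{𝓕(d)^*}(ℚ, T^∨(1))` for the dual
Selmer group of `𝓕(d)` for the full-level family `inv'` (print's `H¹_{𝓕^*(d)}(K, T^∨(1))`,
`(𝓕(d))^* = 𝓕^*(d)`): **`(δ(κ)_d) = (#N_d) · ℤ/3^m`** as ideals of `ℤ/3^m` — which is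
"`I_R(δ(κ)_d) = Fitt⁰_R(H¹_{𝓕^*(d)}(K, T^∨(1))^∨)`" for `R = ℤ/3^m`: `I_R(x) = (x)` for `x ∈ R`
(`KolyvaginSystem.idealOfElement_self`; `δ(κ)_d ∈ R ⊗_ℤ G_d ≅ R` by the fixed generators, [S21]
Def. 5.7) and `Fitt⁰_R(N^∨) = Fitt⁰_ℤ(N^∨)·R = (#N)·R` for a finite `R`-module `N` (the Pontryagin
dual has the same elementary divisors), the unfolding of `Sakamoto2024KolyvaginFittingIdeal.lean`.
Weaker than print: `R = ℤ/3^m`, `K = ℚ` only.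
[cite: Sakamoto2024, Thm. 8.5 (3) (p. 938) with Def. 8.1 (p. 937), Def. 4.2 and Rem. 4.3 (p. 926)]
[cite: Sakamoto2021RankZero, Def. 5.7 and Thm. 5.8 (i) (pp. 1093–1094)]
[cite: Kim2022StructureSelmer, §2.2.2 (generator-fixed convention)] -/
def kolyvaginSystemsZero_span_delta_eq_zmod_three_pow_at (m : ℕ) [NeZero m] : Prop :=
  ∀ (M : Type) [AddCommGroup M] [TopologicalSpace M] [DiscreteTopology M] [Finite M]
    (Mbar : Type) [AddCommGroup Mbar] [TopologicalSpace Mbar] [DiscreteTopology Mbar] [Finite Mbar]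
    [Module (ZMod (3 ^ m)) M] [Module.Free (ZMod (3 ^ m)) M] [Module.Finite (ZMod (3 ^ m)) M]
    (ρ : DiscreteGaloisModule ℚ M) (ρbar : DiscreteGaloisModule ℚ Mbar)
    (red : ρ.toContRepresentation →ⁱL ρbar.toContRepresentation)
    (incl : ρbar.toContRepresentation →ⁱL ρ.toContRepresentation)
    (τ : absoluteGaloisGroup ℚ)
    (θ : ρbar.toContRepresentation →ⁱL (ρbar.tateDual 3).toContRepresentation)
    (inv : LocalInvariants ℚ 3)
    (S : Finset (Place ℚ)) (𝓕 : SelmerStructure ρ) (D : KolyvaginDatum ρ)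
    (η : (q : HeightOneSpectrum (𝓞 ℚ)) → (ZMod (Ideal.absNorm q.asIdeal))ˣ)
    (t : (q : HeightOneSpectrum (𝓞 ℚ)) → SingularQuotient (GaloisRep.toLocal q ρ) →+ ZMod (3 ^ m)),
    -- the residual pair is `T ↠ T/3T`, `T/3T ↪ T` with `incl ∘ red = 3^{m-1}`
    Function.Surjective red →
    (∀ x : M, red x = 0 ↔ ∃ y : M, x = (3 : ℤ) • y) →
    (∀ x : M, incl (red x) = ((3 : ℤ) ^ (m - 1)) • x) →
    -- (H.1)
    (∀ H : AddSubgroup Mbar, (∀ (σ : absoluteGaloisGroup ℚ) (x : Mbar), x ∈ H → ρbar σ x ∈ H) →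
      H = ⊥ ∨ H = ⊤) →
    -- (H.2)
    τ ∈ rootsOfUnityFixer ℚ (3 ^ m) → Nonempty (cokerSubOne ρ τ ≃+ ZMod (3 ^ m)) →
    -- (H.3)
    (∀ f : contOneCocycles ρbar.toTopRep,
      (∀ u : absoluteGaloisGroup ℚ, ρ u = 1 → u ∈ rootsOfUnityFixer ℚ (3 ^ m) → f.1 u = 0) →
        oneCocycleClass ρbar.toTopRep f = 0) →
    -- (H.SD)
    Function.Bijective θ →
    -- the residual local duality family (Poitou–Tate), for the conditions of Def. 8.2 on `T̄`
    inv.IsPerfect → inv.SumLocalTermEqZero → inv.UnramifiedOrthogonal → inv.SelmerComplement →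
    -- `S(𝓕) = S ⊇ {∞, 3} ∪ S_ram(T)`, `H¹_ur` outside `S`
    (∀ w : InfinitePlace ℚ, (Sum.inl w : Place ℚ) ∈ S) →
    (∀ v : HeightOneSpectrum (𝓞 ℚ), (Sum.inr v : Place ℚ) ∉ S →
      ((3 : ℕ) : 𝓞 ℚ) ∉ v.asIdeal ∧ GaloisRep.IsUnramifiedAt v ρ) →
    𝓕.IsUnramifiedOutside S →
    -- the hypotheses of Thm. 8.5 on `𝓕`: cartesian (Def. 3.5) and residually self-dual (Def. 8.2)
    𝓕.IsCartesian red incl S →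
    inv.IsResiduallySelfDual (𝓕.induced red) θ S →
    -- the Kolyvagin datum: Sakamoto's `𝒫`, the transverse conditions, THE comparison maps
    -- (canonical on `H¹_ur`, zero on `H¹_tr`: `φ^{fs}_𝔮 ∘ pr_ur`)
    D.primes = frobeniusClassPrimes ρ {v | (Sum.inr v : Place ℚ) ∈ S} τ (3 ^ m) →
    D.transverse = cyclotomicTransverse ρ →
    D.HasCanonicalComparison (3 ^ m) η →
    D.VanishesOnTransverse →
    -- §8: the fixed isomorphisms `H¹_{/ur}(ℚ_𝔮, T) ≅ R` at the primes of `𝒫`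
    (∀ q ∈ D.primes, Function.Bijective (t q)) →
    -- a Poitou–Tate family at the FULL level `3^m`, for the dual Selmer groups
    -- `N_d = H¹_{𝓕(d)^*}(ℚ, T^∨(1))`, `T^∨(1) = Hom(T, μ_{3^m}) = ρ.tateDual (3^m)`
    ∀ inv' : LocalInvariants ℚ (3 ^ m),
      inv'.IsPerfect → inv'.SumLocalTermEqZero → inv'.UnramifiedOrthogonal → inv'.SelmerComplement →
    -- conclusion (3), unfolded for `R = ℤ/3^m`: if `KS₀(T, 𝓕)` is free of rank one, then for every
    -- basis `κ` and every level `d`, `(δ(κ)_d) = (#N_d)` as ideals of `ℤ/3^m`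
    KolyvaginSystem.IsFreeRankOneZMod (D.kolyvaginSystemsZero (3 ^ m) t 𝓕) (3 ^ m) →
      ∀ κ : D.kolyvaginSystemsZero (3 ^ m) t 𝓕, AddSubgroup.zmultiples κ = ⊤ →
        ∀ d : Finset (HeightOneSpectrum (𝓞 ℚ)), D.IsLevel d →
          Ideal.span {D.delta (3 ^ m) t κ.1 d} =
            Ideal.span {((Nat.card (inv'.dualSelmerStructure ρ (D.atLevel 𝓕 d)).selmerGroup : ℕ) :
              ZMod (3 ^ m))}


/-! ## Appended (same seat, gen 2): "`R·δ_n(κ) ⊆ Fitt⁰`" for EVERY `κ ∈ KS₀` — the pure algebra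
behind [S21] Thm. 5.8 (i), first clause, and the `E`-free shadow of [S24] Cor. 9.14 -/

/-- **From Thm. 8.5 (2)–(3) to the inclusion for an ARBITRARY rank-zero Kolyvagin system**
([S21] Thm. 5.8 (i): "For each ideal `n ∈ 𝒩(Q)`, we have `R·δ_n ⊆ Fitt⁰_R(H¹_{𝓕(n)^*}(k, T^∨(1))^∨)`,
with equality if `κ` is a basis of `KS₀(T, 𝓕, Q)`"; [S24] Cor. 9.14 applies this to `κ = κ_E`):
the passage from the basis case to every `κ` is pure algebra over `R = ℤ/N` — if `X` (here
`KS₀(T, 𝓕)`) is free of rank one over `ℤ/N`, `δ : X → ℤ/N` is additive (here `deltaHom d`) and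
`(δ(κ₀)) = (c)` for every generator `κ₀` of `X` (the conclusion of
`kolyvaginSystemsZero_span_delta_eq_zmod_three_pow_at`, `c = #N_d`), then `(δ(κ)) ⊆ (c)` for every
`κ ∈ X`, since `κ = k·κ₀` and `δ(κ) = k·δ(κ₀)`.  PROVED; consumers holding the conclusions of the two
facts above obtain [S21] Thm. 5.8 (i) (first clause) for `R = ℤ/3^m` with `δ := deltaHom d`.
[cite: Sakamoto2021RankZero, Thm. 5.8 (i) (pp. 1093–1094)] [cite: Sakamoto2024, Cor. 9.14 (p. 945)] -/
theorem _root_.Literature.NumberTheory.GaloisCohomology.KolyvaginSystem.span_apply_le_of_isFreeRankOneZMod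
    {X : Type*} [AddCommGroup X] {N : ℕ} [NeZero N]
    (hX : KolyvaginSystem.IsFreeRankOneZMod X N) (δ : X →+ ZMod N) (c : ZMod N)
    (hbasis : ∀ κ₀ : X, AddSubgroup.zmultiples κ₀ = ⊤ → Ideal.span {δ κ₀} = Ideal.span {c})
    (κ : X) : Ideal.span {δ κ} ≤ Ideal.span {c} := by
  obtain ⟨e⟩ := hX
  -- the generator `κ₀ = e⁻¹(1)`
  set κ₀ : X := e.symm 1 with hκ₀
  have hgen : AddSubgroup.zmultiples κ₀ = ⊤ := by
    rw [eq_top_iff]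
    intro x _
    have hx : x = ((e x).val : ℤ) • κ₀ := by
      apply e.injective
      rw [map_zsmul, hκ₀, e.apply_symm_apply, zsmul_eq_mul, mul_one, Int.cast_natCast,
        ZMod.natCast_zmod_val]
    rw [hx]
    exact AddSubgroup.zsmul_mem _ (AddSubgroup.mem_zmultiples κ₀) _
  have h0 := hbasis κ₀ hgen
  obtain ⟨k, rfl⟩ : ∃ k : ℤ, k • κ₀ = κ := by
    have hκ : κ ∈ AddSubgroup.zmultiples κ₀ := by rw [hgen]; trivial
    exact AddSubgroup.mem_zmultiples_iff.mp hκ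
  rw [map_zsmul, ← h0, Ideal.span_singleton_le_iff_mem, zsmul_eq_mul]
  exact Ideal.mul_mem_left _ _ (Ideal.mem_span_singleton_self _)

end Literature.NumberTheory.GaloisCohomology.Sakamoto2024

end
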